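import Summits.HubbardSuperconductivity.HubbardSuperconductivity.Theorems.AnisotropyChordTransferFibre3KT1Targets

/-!
# Route `AnisotropyChord` / H0 rotor rung: PORT PartN38 — THE ANALYTIC REGIME OF FAMILY A: the seven elementary lemmas behind the certified L-uniform enclosures LEMMA A0 (`G̃_λ(0) − ln L/2π`) and LEMMA A1 (diagonal kernel values `a_L(n,n;λ)`)

Verbatim port (modulo this header, the port comment, lint options and one added docstring) of the theory seat's statement file
`hubbard-h0-rotor-theory-1/cycle21/lean/PartN38.lean` (sha16 `99da4d7e8be8e123`; theory seat `hubbard-h0-rotor-theory-1` g21, REPORT 27,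
memo ROTOR-THEORY-21 §316; THEOREMS M131; evaluators cycle21/calc/encl_g0.py, encl_diag.py).
Statements (`def … : Prop` targets typed by the theory seat — generic real analysis: `SumCscSq`, `SumCscFourth`, `OddSineSum`,
`PsiConvex`, `HConvex`, `PsiZeroPrimitive`, `CscCubedPrimitive`, `TrapezoidConvex`, `MonotoneBrackets`) plus the one lemma the
theory file itself proves (`oddSineSum_one`); no further proof claimed here.
Prover seat `hubbard-h0-rotor-p2` g0; helper for stmt-HubbardSuperconductivity-19089 (`--supports`, helper class).
WHAT THIS IS NOT: nothing here proves superconductivity in the Hubbard model; the rotor TARGET as originally worded stays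
FALSE (g15 verdict) — these are helper statements of ONE conditional reduction (rung 19089: GM₃ ∀L certificate; Level-2 row
evaluators of the KT certificate / HOLE₂(.75) family A).  Mathlib + the KT1 targets layer (namespace only); no sorry, no axioms.

Theory seat's own summary of the file:

# PartN38 — THE ANALYTIC REGIME OF FAMILY A: the seven elementary lemmas behind the certified L-uniform enclosures
# LEMMA A0 (`G̃_λ(0) − ln L/2π`) and LEMMA A1 (diagonal kernel values `a_L(n,n;λ)`)  (memo ROTOR-THEORY-21 §316; THEOREMS M131;
# evaluators cycle21/calc/encl_g0.py, encl_diag.py — validated against the exact row formulas for L = 32…8192 in both regimes)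

The enclosures are finite compositions of: the exact row/diagonal decompositions (PartN35 `GRowFormula`, PartN37 `DiagRotation`,
`RingResolventSum(Shift)(Trig)`), the two lattice identities `SumCscSq`, `SumCscFourth`, the convexity of the row profiles
(`PsiConvex`, `HConvex` — proved on paper by the elementary inequalities `c³ − c² − 5c + 9 > 0`, `12c² ≥ 8c² − 4`), the ONE-SIDED
trapezoidal Euler–Maclaurin bound for convex summands (`TrapezoidConvex`), the closed-form primitives `PsiZeroPrimitive`,
`CscCubedPrimitive`, the odd-sine identity `OddSineSum` (which evaluates `∫₀^π (1 − cos 2nu)/(4 sin u) du = Σ_{j≤n} 1/(2j−1)`, i.e.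
`a_∞(n,n) = (1/π)Σ_{j≤n} 1/(2j−1)`), and monotone brackets (`sin x ≤ x`, `sin x/x` decreasing on `[0,π]`, Jordan, `arsinh y ∈ [y − y³/6, y]`,
`arcsin z ≤ z/√(1−z²)`).  Everything here is generic real analysis (Mathlib-level); the statements are recorded as `Prop`s so that the
port can cite them by name.  Mathlib only (plus the KT1 targets layer for the namespace).
-/

-- Port of theory seat `hubbard-h0-rotor-theory-1` cycle21/lean/PartN38.lean (sha16 99da4d7e8be8e123) verbatim modulo this header,
-- lint options and lint fixes; prover seat `hubbard-h0-rotor-p2` g0, `--supports stmt-HubbardSuperconductivity-19089`.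

set_option linter.dupNamespace false
noncomputable section

open scoped BigOperators

namespace Summit.HubbardSuperconductivity.HubbardSuperconductivity.Theorems.AnisotropyChord.Transfer.Fibre3

/-! ## Lattice trigonometric identities -/

/-- `Σ_{n=1}^{L−1} 1/sin²(πn/L) = (L² − 1)/3` (L ≥ 1). -/
def SumCscSq : Prop :=
  ∀ L : ℕ, 1 ≤ L → (∑ n ∈ Finset.Ico 1 L, 1 / Real.sin (Real.pi * n / L) ^ 2) = ((L : ℝ) ^ 2 - 1) / 3

/-- `Σ_{n=1}^{L−1} 1/sin⁴(πn/L) = (L² − 1)(L² + 11)/45` (L ≥ 1). -/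
def SumCscFourth : Prop :=
  ∀ L : ℕ, 1 ≤ L →
    (∑ n ∈ Finset.Ico 1 L, 1 / Real.sin (Real.pi * n / L) ^ 4) = ((L : ℝ) ^ 2 - 1) * ((L : ℝ) ^ 2 + 11) / 45

/-- odd-sine identity: `sin u · Σ_{j=1}^{n} sin((2j−1)u) = sin²(nu)` (all real `u`; for `sin u ≠ 0` it is
`sin²(nu)/sin u = Σ_j sin((2j−1)u)`, whence `∫₀^π sin²(nu)/sin u du = Σ_{j≤n} 2/(2j−1)`). -/
def OddSineSum : Prop :=
  ∀ n : ℕ, ∀ u : ℝ,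
    Real.sin u * (∑ j ∈ Finset.Icc 1 n, Real.sin ((2 * (j : ℝ) - 1) * u)) = Real.sin (n * u) ^ 2

/-! ## Row profiles: convexity and primitives -/

/-- the row profile of the `r = 0` formula, `ψ_a(k) = 1/(4√((s² − a)(1 + s² − a)))`, `s = sin(k/2)` (`= 1/(2 sinh μ(k))`). -/
def psiRow (a k : ℝ) : ℝ := 1 / (4 * Real.sqrt ((Real.sin (k / 2) ^ 2 - a) * (1 + Real.sin (k / 2) ^ 2 - a)))

/-- CONVEXITY of `ψ_a` on the hyperbolic range `{k ∈ (0, 2π) : sin²(k/2) > a}` for `0 ≤ a < 1` (paper proof: with `c = cos k` the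
sign of `ψ''` reduces to `c³ − c² − 5c + 9 > 0` on `[−1,1]`). -/
def PsiConvex : Prop :=
  ∀ a : ℝ, 0 ≤ a → a < 1 →
    ConvexOn ℝ {k : ℝ | 0 < k ∧ k < 2 * Real.pi ∧ a < Real.sin (k / 2) ^ 2} (psiRow a)

/-- the far-row profile of the diagonal formula, `h_b(u) = 1/(4√(b² − cos²u))` (`b = 1 − a`), is CONVEX on `(arccos b, π − arccos b)`
for `0 < b ≤ 1` (paper proof: reduces to `12cos²u ≥ 8cos²u − 4`). -/
def HConvex : Prop :=
  ∀ b : ℝ, 0 < b → b ≤ 1 →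
    ConvexOn ℝ {u : ℝ | Real.arccos b < u ∧ u < Real.pi - Real.arccos b} (fun u => 1 / (4 * Real.sqrt (b ^ 2 - Real.cos u ^ 2)))

/-- closed-form primitive of `ψ₀`: `d/dk [−(1/4) ln((1 + √(1 − s⁴))/s²)] = 1/(4 s √(1 + s²))`, `s = sin(k/2)`, on `(0, 2π)`. -/
def PsiZeroPrimitive : Prop :=
  ∀ k : ℝ, 0 < k → k < 2 * Real.pi →
    HasDerivAt (fun k => -(1 / 4 : ℝ) * Real.log ((1 + Real.sqrt (1 - Real.sin (k / 2) ^ 4)) / Real.sin (k / 2) ^ 2))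
      (1 / (4 * Real.sin (k / 2) * Real.sqrt (1 + Real.sin (k / 2) ^ 2))) k

/-- primitive of `csc³`: `d/dx [−(1/2)(cos x/sin²x) − (1/2) ln cot(x/2)] = 1/sin³x` on `(0, π)`. -/
def CscCubedPrimitive : Prop :=
  ∀ x : ℝ, 0 < x → x < Real.pi →
    HasDerivAt (fun x => -(1 / 2 : ℝ) * (Real.cos x / Real.sin x ^ 2) - (1 / 2) * Real.log (1 / Real.tan (x / 2)))
      (1 / Real.sin x ^ 3) x

/-! ## One-sided trapezoidal Euler–Maclaurin for convex summands -/

/-- for `f` convex and continuously differentiable on `[A, B]` (`A < B` integers):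
`0 ≤ Σ_{m=A}^{B} f(m) − ∫_A^B f − (f(A) + f(B))/2 ≤ (f'(B) − f'(A))/8`
(the periodic Bernoulli kernel `P̃₂(x) = ({x}² − {x})/2 ∈ [−1/8, 0]`). -/
def TrapezoidConvex : Prop :=
  ∀ (f f' : ℝ → ℝ) (A B : ℤ), A < B →
    ConvexOn ℝ (Set.Icc (A : ℝ) B) f →
    (∀ x ∈ Set.Icc (A : ℝ) B, HasDerivAt f (f' x) x) → ContinuousOn f' (Set.Icc (A : ℝ) B) →
      0 ≤ (∑ m ∈ Finset.Icc A B, f m) - (∫ x in (A : ℝ)..B, f x) - (f A + f B) / 2 ∧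
        (∑ m ∈ Finset.Icc A B, f m) - (∫ x in (A : ℝ)..B, f x) - (f A + f B) / 2 ≤ (f' B - f' A) / 8

/-! ## Monotone brackets used by the evaluators (all standard) -/

/-- `y − y³/6 ≤ arsinh y ≤ y` for `y ≥ 0`; `arsinh y ≥ 0.8813 y` for `0 ≤ y ≤ 1`; `arcsin z ≤ z/√(1 − z²)` for `0 ≤ z < 1`;
`sin x/x` is antitone on `(0, π]`; `2x/π ≤ sin x` on `[0, π/2]`. -/
def MonotoneBrackets : Prop :=
  (∀ y : ℝ, 0 ≤ y → y - y ^ 3 / 6 ≤ Real.arsinh y ∧ Real.arsinh y ≤ y) ∧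
  (∀ y : ℝ, 0 ≤ y → y ≤ 1 → 0.8813 * y ≤ Real.arsinh y) ∧
  (∀ z : ℝ, 0 ≤ z → z < 1 → Real.arcsin z ≤ z / Real.sqrt (1 - z ^ 2)) ∧
  AntitoneOn (fun x : ℝ => Real.sin x / x) (Set.Ioc 0 Real.pi) ∧
  (∀ x : ℝ, 0 ≤ x → x ≤ Real.pi / 2 → 2 * x / Real.pi ≤ Real.sin x)

/-! ## A proved instance (sanity): the odd-sine identity for `n = 1`. -/

/-- `OddSineSum` at `n = 1`: `sin u · sin u = sin² u`. [port: docstring added.] -/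
theorem oddSineSum_one (u : ℝ) :
    Real.sin u * (∑ j ∈ Finset.Icc (1 : ℕ) 1, Real.sin ((2 * (j : ℝ) - 1) * u)) = Real.sin ((1 : ℕ) * u) ^ 2 := by
  norm_num [Finset.Icc_self, pow_two]

end Summit.HubbardSuperconductivity.HubbardSuperconductivity.Theorems.AnisotropyChord.Transfer.Fibre3

end
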